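import Literature.NumberTheory.Transcendental.DolbeaultIntegrabilityProofs
import Literature.NumberTheory.Transcendental.DolbeaultProofs
import Literature.NumberTheory.Transcendental.ComplexFormsSmoothProofs
import Literature.NumberTheory.Transcendental.FormsAlgebraWedgeAssocProofs
import Literature.NumberTheory.Transcendental.FormsAlgebraWedgeCommProofs
import HarnessLib

/-!
# Leibniz rules for `∂̄` and `∂` (discharge of `dolbeaultBar_wedge` and `dolbeault_wedge`)

Trunk **T-KAEHLER** (`NumberTheory/Transcendental`). Theorems-only leaf companion of
`Dolbeault.lean`, discharging its two named facts

* `dolbeaultBar_wedge` — `∂̄(α ∧ β) = ∂̄α ∧ β + (-1)^k α ∧ ∂̄β` for smooth complex forms `α` (degree `k`)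
  and `β` on a complex manifold (the first summand cast from degree `(k + 1) + l` to `(k + l) + 1`);
* `dolbeault_wedge` — `∂(α ∧ β) = ∂α ∧ β + (-1)^k α ∧ ∂β`;

C. Voisin, *Hodge Theory and Complex Algebraic Geometry I* (2002), §2.3.3 (the Leibniz rule for `∂̄`,
stated after Def. 2.30 / Prop. 2.31); P. Griffiths, J. Harris (1978), p. 24; D. Huybrechts (2005),
Lemma 1.3.6 / Prop. 2.6.15.

Proof as printed. For forms of pure types `(a,b)` and `(c,d)`: `α ∧ β` has type `(a+c, b+d)`
(`IsOfType.wedge_holds`), so `∂̄(α ∧ β) = (d(α ∧ β))^{a+c,b+d+1}` (`IsOfType.dolbeaultBar_eq_holds`);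
`d(α ∧ β) = dα ∧ β + (-1)^k α ∧ dβ` (`mextDeriv_wedge`, the `WedgeFacts` package from the proved
graded commutativity `ContinuousAlternatingMap.WedgeComm_holds`); `d = ∂ + ∂̄`
(`mextDeriv_eq_dolbeault_add_dolbeaultBar_holds`) splits each summand into a part of type
`(a+c+1, b+d)` and a part of type `(a+c, b+d+1)` (`IsOfType.dolbeault_holds`, `IsOfType.dolbeaultBar_holds`,
`IsOfType.wedge_holds`), of which the projection keeps exactly the second
(`IsOfType.typeComponent_eq_self`, `IsOfType.typeComponent_of_ne_holds`). General smooth forms are sums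
of their type components (`sum_antidiagonal_typeComponent_holds`, smooth by
`isSmoothForm_typeComponent_holds`), and both sides are additive in each argument on smooth forms
(`dolbeaultBar_add`, `MForm.wedge_add_left/right`). The `∂`-rule is the same computation with the
projection onto type `(a+c+1, b+d)`.

* `dolbeaultBar_wedge_of_isOfType`, `dolbeault_wedge_of_isOfType` — the pure-type cases;
* **`dolbeaultBar_wedge_holds`**, **`dolbeault_wedge_holds`** — discharges of the named facts.

No definition and no named fact is introduced (D-0026).

## References

* C. Voisin, *Hodge Theory and Complex Algebraic Geometry I* (2002), §2.3.1, §2.3.3.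
  [Voisin2002] [VoisinHodgeI2002]
* D. Huybrechts, *Complex Geometry* (2005), Lemma 1.3.6, Prop. 2.6.15. [Huybrechts2005]
* P. Griffiths, J. Harris, *Principles of Algebraic Geometry* (1978), p. 24. [GriffithsHarris1978]
-/

noncomputable section

open scoped Manifold ContDiff
open Finset Literature.Geometry.Kaehler

namespace Literature.NumberTheory.Transcendental

variable {E : Type*} [NormedAddCommGroup E] [NormedSpace ℂ E]
  {M : Type*} [TopologicalSpace M] [ChartedSpace E M] {k l : ℕ}

/-! ### Algebraic preliminaries (no atlas hypothesis) -/

/-- The degree cast preserves types (the rotations commute with reindexing). [cite: Voisin2002, §2.3.1] -/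
theorem IsOfType.castDeg_of_eq {k' p q : ℕ} (h : k = k') {α : MForm 𝓘(ℝ, E) M ℂ k}
    (hα : IsOfType p q α) : IsOfType p q (α.castDeg h) := by
  subst h
  exact hα

/-- Type components commute with real scalars (a Summits-side file proves the same lemma; kept
private here, Literature may not import Summits). [folklore] -/
private theorem typeComponent_real_smul (p q : ℕ) (c : ℝ) (α : MForm 𝓘(ℝ, E) M ℂ k) :
    (c • α).typeComponent p q = c • α.typeComponent p q := by
  rw [← Complex.coe_smul, MForm.typeComponent_smul, Complex.coe_smul]

/-- `∂̄` commutes with real scalars. [cite: Voisin2002, §2.3.3] -/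
theorem dolbeaultBar_real_smul (c : ℝ) (α : MForm 𝓘(ℝ, E) M ℂ k) :
    dolbeaultBar (c • α) = c • dolbeaultBar α := by
  rw [← Complex.coe_smul, dolbeaultBar_smul_holds, Complex.coe_smul]

/-- `∂` commutes with real scalars. [cite: Voisin2002, §2.3.3] -/
theorem dolbeault_real_smul (c : ℝ) (α : MForm 𝓘(ℝ, E) M ℂ k) :
    dolbeault (c • α) = c • dolbeault α := by
  rw [← Complex.coe_smul, dolbeault_smul_holds, Complex.coe_smul]

/-! ### Pure types -/

section PureType

variable [IsManifold 𝓘(ℂ, E) ω M] [IsManifold 𝓘(ℝ, E) ∞ M]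

/-- The `(a+c, b+d+1)`-component of `dα ∧ β` (cast to degree `(k+l)+1`) is `∂̄α ∧ β`, and of
`α ∧ dβ` is `α ∧ ∂̄β`, for `α`, `β` smooth of types `(a,b)`, `(c,d)` — the type bookkeeping of the
Leibniz rule. [cite: Voisin2002, §2.3.3] -/
theorem typeComponent_mextDeriv_wedge_of_isOfType {a b c d : ℕ} {α : MForm 𝓘(ℝ, E) M ℂ k}
    {β : MForm 𝓘(ℝ, E) M ℂ l} (hα : IsOfType a b α) (hβ : IsOfType c d β) (hαs : IsSmoothForm α)
    (hβs : IsSmoothForm β) :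
    (((mextDeriv α).wedge β).castDeg (Nat.add_right_comm k 1 l)).typeComponent (a + c) (b + d + 1) =
        ((dolbeaultBar α).wedge β).castDeg (Nat.add_right_comm k 1 l) ∧
      (α.wedge (mextDeriv β)).typeComponent (a + c) (b + d + 1) = α.wedge (dolbeaultBar β) ∧
      (((mextDeriv α).wedge β).castDeg (Nat.add_right_comm k 1 l)).typeComponent (a + c + 1) (b + d) =
        ((dolbeault α).wedge β).castDeg (Nat.add_right_comm k 1 l) ∧
      (α.wedge (mextDeriv β)).typeComponent (a + c + 1) (b + d) = α.wedge (dolbeault β) := by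
  -- types of the four pieces
  have h1 : IsOfType (a + c + 1) (b + d) (((dolbeault α).wedge β).castDeg (Nat.add_right_comm k 1 l)) := by
    have := IsOfType.wedge_holds (IsOfType.dolbeault_holds hα) hβ
    rw [show a + 1 + c = a + c + 1 by ring] at this
    exact this.castDeg_of_eq _
  have h2 : IsOfType (a + c) (b + d + 1) (((dolbeaultBar α).wedge β).castDeg (Nat.add_right_comm k 1 l)) := by
    have := IsOfType.wedge_holds (IsOfType.dolbeaultBar_holds hα) hβ
    rw [show b + 1 + d = b + d + 1 by ring] at this
    exact this.castDeg_of_eq _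
  have h3 : IsOfType (a + c + 1) (b + d) (α.wedge (dolbeault β)) := by
    have := IsOfType.wedge_holds hα (IsOfType.dolbeault_holds hβ)
    rw [show a + (c + 1) = a + c + 1 by ring] at this
    exact this
  have h4 : IsOfType (a + c) (b + d + 1) (α.wedge (dolbeaultBar β)) := by
    have := IsOfType.wedge_holds hα (IsOfType.dolbeaultBar_holds hβ)
    rw [show b + (d + 1) = b + d + 1 by ring] at this
    exact this
  have hdα : mextDeriv α = dolbeault α + dolbeaultBar α := mextDeriv_eq_dolbeault_add_dolbeaultBar_holds hαs
  have hdβ : mextDeriv β = dolbeault β + dolbeaultBar β := mextDeriv_eq_dolbeault_add_dolbeaultBar_holds hβs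
  refine ⟨?_, ?_, ?_, ?_⟩
  · rw [hdα, MForm.wedge_add_left, MForm.castDeg_add, MForm.typeComponent_add,
      IsOfType.typeComponent_of_ne_holds h1 (Or.inl (by omega)), h2.typeComponent_eq_self, zero_add]
  · rw [hdβ, MForm.wedge_add_right, MForm.typeComponent_add,
      IsOfType.typeComponent_of_ne_holds h3 (Or.inl (by omega)), h4.typeComponent_eq_self, zero_add]
  · rw [hdα, MForm.wedge_add_left, MForm.castDeg_add, MForm.typeComponent_add,
      h1.typeComponent_eq_self, IsOfType.typeComponent_of_ne_holds h2 (Or.inl (by omega)), add_zero]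
  · rw [hdβ, MForm.wedge_add_right, MForm.typeComponent_add,
      h3.typeComponent_eq_self, IsOfType.typeComponent_of_ne_holds h4 (Or.inl (by omega)), add_zero]

/-- **Leibniz rule for `∂̄`, pure types**: for smooth `α` of type `(a,b)` and `β` of type `(c,d)`,
`∂̄(α ∧ β) = ∂̄α ∧ β + (-1)^k α ∧ ∂̄β`. [cite: Voisin2002, §2.3.3] -/
theorem dolbeaultBar_wedge_of_isOfType {a b c d : ℕ} {α : MForm 𝓘(ℝ, E) M ℂ k}
    {β : MForm 𝓘(ℝ, E) M ℂ l} (hα : IsOfType a b α) (hβ : IsOfType c d β) (hαs : IsSmoothForm α)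
    (hβs : IsSmoothForm β) :
    dolbeaultBar (α.wedge β) =
      ((dolbeaultBar α).wedge β).castDeg (Nat.add_right_comm k 1 l) +
        ((-1 : ℝ) ^ k) • α.wedge (dolbeaultBar β) := by
  haveI : WedgeFacts 𝓘(ℝ, E) M ℂ :=
    wedgeFacts_of_comm (ContinuousAlternatingMap.WedgeComm_holds ℝ E ℂ)
  obtain ⟨e1, e2, -, -⟩ := typeComponent_mextDeriv_wedge_of_isOfType hα hβ hαs hβs
  rw [IsOfType.dolbeaultBar_eq_holds (IsOfType.wedge_holds hα hβ), mextDeriv_wedge hαs hβs,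
    MForm.typeComponent_add, typeComponent_real_smul, e1, e2]

/-- **Leibniz rule for `∂`, pure types**: for smooth `α` of type `(a,b)` and `β` of type `(c,d)`,
`∂(α ∧ β) = ∂α ∧ β + (-1)^k α ∧ ∂β`. [cite: Voisin2002, §2.3.3] -/
theorem dolbeault_wedge_of_isOfType {a b c d : ℕ} {α : MForm 𝓘(ℝ, E) M ℂ k}
    {β : MForm 𝓘(ℝ, E) M ℂ l} (hα : IsOfType a b α) (hβ : IsOfType c d β) (hαs : IsSmoothForm α)
    (hβs : IsSmoothForm β) :
    dolbeault (α.wedge β) =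
      ((dolbeault α).wedge β).castDeg (Nat.add_right_comm k 1 l) +
        ((-1 : ℝ) ^ k) • α.wedge (dolbeault β) := by
  haveI : WedgeFacts 𝓘(ℝ, E) M ℂ :=
    wedgeFacts_of_comm (ContinuousAlternatingMap.WedgeComm_holds ℝ E ℂ)
  obtain ⟨-, -, e3, e4⟩ := typeComponent_mextDeriv_wedge_of_isOfType hα hβ hαs hβs
  have h := IsOfType.dolbeault_eq_holds (IsOfType.wedge_holds hα hβ)
  rw [show a + c + 1 = a + c + 1 from rfl] at h
  rw [h, mextDeriv_wedge hαs hβs, MForm.typeComponent_add, typeComponent_real_smul,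
    show a + c + 1 = a + c + 1 from rfl, e3, e4]

end PureType

/-! ### General smooth forms, by additivity over the type decomposition -/

section General

variable [IsManifold 𝓘(ℂ, E) ω M] [IsManifold 𝓘(ℝ, E) ∞ M]

omit [IsManifold 𝓘(ℂ, E) ω M] [IsManifold 𝓘(ℝ, E) ∞ M] in
/-- A finite sum of smooth forms is smooth. [folklore] -/
private theorem isSmoothForm_sum {ι : Type*} (s : Finset ι) {f : ι → MForm 𝓘(ℝ, E) M ℂ k}
    (hf : ∀ i ∈ s, IsSmoothForm (f i)) : IsSmoothForm (∑ i ∈ s, f i) :=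
  Finset.sum_induction _ IsSmoothForm (fun _ _ ha hb ↦ ha.add hb) isSmoothForm_zero hf

omit [IsManifold 𝓘(ℂ, E) ω M] [IsManifold 𝓘(ℝ, E) ∞ M] in
/-- The wedge product is additive in the left factor over finite sums. [cite: WarnerGTM94, 2.6] -/
theorem sum_wedge_left {ι : Type*} (s : Finset ι) (f : ι → MForm 𝓘(ℝ, E) M ℂ k)
    (β : MForm 𝓘(ℝ, E) M ℂ l) : (∑ i ∈ s, f i).wedge β = ∑ i ∈ s, (f i).wedge β := by
  classical
  induction s using Finset.induction_on with
  | empty => simp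
  | insert i s hi ih => rw [sum_insert hi, sum_insert hi, MForm.wedge_add_left, ih]

omit [IsManifold 𝓘(ℂ, E) ω M] [IsManifold 𝓘(ℝ, E) ∞ M] in
/-- The wedge product is additive in the right factor over finite sums. [cite: WarnerGTM94, 2.6] -/
theorem sum_wedge_right {ι : Type*} (s : Finset ι) (α : MForm 𝓘(ℝ, E) M ℂ k)
    (f : ι → MForm 𝓘(ℝ, E) M ℂ l) : α.wedge (∑ i ∈ s, f i) = ∑ i ∈ s, α.wedge (f i) := by
  classical
  induction s using Finset.induction_on with
  | empty => simp
  | insert i s hi ih => rw [sum_insert hi, sum_insert hi, MForm.wedge_add_right, ih]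

omit [IsManifold 𝓘(ℂ, E) ω M] [IsManifold 𝓘(ℝ, E) ∞ M] in
/-- The degree cast is additive over finite sums. [folklore] -/
private theorem castDeg_sum {k' : ℕ} (h : k = k') {ι : Type*} (s : Finset ι)
    (f : ι → MForm 𝓘(ℝ, E) M ℂ k) : (∑ i ∈ s, f i).castDeg h = ∑ i ∈ s, (f i).castDeg h := by
  classical
  induction s using Finset.induction_on with
  | empty => simp [MForm.castDeg_zero]
  | insert i s hi ih => rw [sum_insert hi, sum_insert hi, MForm.castDeg_add, ih]

/-- **Leibniz rule for `∂̄`, pure-type left factor** and general smooth right factor.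
[cite: Voisin2002, §2.3.3] -/
theorem dolbeaultBar_wedge_of_isOfType_left {a b : ℕ} {α : MForm 𝓘(ℝ, E) M ℂ k}
    (hα : IsOfType a b α) (hαs : IsSmoothForm α) {β : MForm 𝓘(ℝ, E) M ℂ l} (hβs : IsSmoothForm β) :
    dolbeaultBar (α.wedge β) =
      ((dolbeaultBar α).wedge β).castDeg (Nat.add_right_comm k 1 l) +
        ((-1 : ℝ) ^ k) • α.wedge (dolbeaultBar β) := by
  haveI : WedgeFacts 𝓘(ℝ, E) M ℂ :=
    wedgeFacts_of_comm (ContinuousAlternatingMap.WedgeComm_holds ℝ E ℂ)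
  have hβc : ∀ pq ∈ antidiagonal l, IsSmoothForm (β.typeComponent pq.1 pq.2) :=
    fun pq _ ↦ isSmoothForm_typeComponent_holds _ _ hβs
  conv_lhs => rw [← sum_antidiagonal_typeComponent_holds β, sum_wedge_right]
  rw [dolbeaultBar_sum _ _ fun pq hpq ↦ isSmoothForm_wedge hαs (hβc pq hpq)]
  rw [Finset.sum_congr rfl fun pq hpq ↦ dolbeaultBar_wedge_of_isOfType hα
    (isOfType_typeComponent_holds (mem_antidiagonal.1 hpq) β) hαs (hβc pq hpq)]
  rw [sum_add_distrib, ← castDeg_sum, ← sum_wedge_right, ← smul_sum, ← sum_wedge_right,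
    ← dolbeaultBar_sum _ _ hβc, sum_antidiagonal_typeComponent_holds β]

/-- **Leibniz rule for `∂`, pure-type left factor** and general smooth right factor.
[cite: Voisin2002, §2.3.3] -/
theorem dolbeault_wedge_of_isOfType_left {a b : ℕ} {α : MForm 𝓘(ℝ, E) M ℂ k}
    (hα : IsOfType a b α) (hαs : IsSmoothForm α) {β : MForm 𝓘(ℝ, E) M ℂ l} (hβs : IsSmoothForm β) :
    dolbeault (α.wedge β) =
      ((dolbeault α).wedge β).castDeg (Nat.add_right_comm k 1 l) +
        ((-1 : ℝ) ^ k) • α.wedge (dolbeault β) := by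
  haveI : WedgeFacts 𝓘(ℝ, E) M ℂ :=
    wedgeFacts_of_comm (ContinuousAlternatingMap.WedgeComm_holds ℝ E ℂ)
  have hβc : ∀ pq ∈ antidiagonal l, IsSmoothForm (β.typeComponent pq.1 pq.2) :=
    fun pq _ ↦ isSmoothForm_typeComponent_holds _ _ hβs
  conv_lhs => rw [← sum_antidiagonal_typeComponent_holds β, sum_wedge_right]
  rw [dolbeault_sum _ _ fun pq hpq ↦ isSmoothForm_wedge hαs (hβc pq hpq)]
  rw [Finset.sum_congr rfl fun pq hpq ↦ dolbeault_wedge_of_isOfType hα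
    (isOfType_typeComponent_holds (mem_antidiagonal.1 hpq) β) hαs (hβc pq hpq)]
  rw [sum_add_distrib, ← castDeg_sum, ← sum_wedge_right, ← smul_sum, ← sum_wedge_right,
    ← dolbeault_sum _ _ hβc, sum_antidiagonal_typeComponent_holds β]

/-- **Leibniz rule for `∂̄`** (discharge of the named fact `dolbeaultBar_wedge`): for smooth complex
forms `α` of degree `k` and `β` on a complex manifold,
`∂̄(α ∧ β) = ∂̄α ∧ β + (-1)^k α ∧ ∂̄β`. [cite: Voisin2002, §2.3.3] -/
theorem dolbeaultBar_wedge_holds : dolbeaultBar_wedge (E := E) (M := M) (k := k) (l := l) := by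
  intro α β hαs hβs
  haveI : WedgeFacts 𝓘(ℝ, E) M ℂ :=
    wedgeFacts_of_comm (ContinuousAlternatingMap.WedgeComm_holds ℝ E ℂ)
  have hαc : ∀ pq ∈ antidiagonal k, IsSmoothForm (α.typeComponent pq.1 pq.2) :=
    fun pq _ ↦ isSmoothForm_typeComponent_holds _ _ hαs
  conv_lhs => rw [← sum_antidiagonal_typeComponent_holds α, sum_wedge_left]
  rw [dolbeaultBar_sum _ _ fun pq hpq ↦ isSmoothForm_wedge (hαc pq hpq) hβs]
  rw [Finset.sum_congr rfl fun pq hpq ↦ dolbeaultBar_wedge_of_isOfType_left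
    (isOfType_typeComponent_holds (mem_antidiagonal.1 hpq) α) (hαc pq hpq) hβs]
  rw [sum_add_distrib, ← castDeg_sum, ← sum_wedge_left, ← dolbeaultBar_sum _ _ hαc, ← smul_sum,
    ← sum_wedge_left, sum_antidiagonal_typeComponent_holds α]

/-- **Leibniz rule for `∂`** (discharge of the named fact `dolbeault_wedge`): for smooth complex forms
`α` of degree `k` and `β` on a complex manifold, `∂(α ∧ β) = ∂α ∧ β + (-1)^k α ∧ ∂β`.
[cite: Voisin2002, §2.3.3] -/
theorem dolbeault_wedge_holds : dolbeault_wedge (E := E) (M := M) (k := k) (l := l) := by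
  intro α β hαs hβs
  haveI : WedgeFacts 𝓘(ℝ, E) M ℂ :=
    wedgeFacts_of_comm (ContinuousAlternatingMap.WedgeComm_holds ℝ E ℂ)
  have hαc : ∀ pq ∈ antidiagonal k, IsSmoothForm (α.typeComponent pq.1 pq.2) :=
    fun pq _ ↦ isSmoothForm_typeComponent_holds _ _ hαs
  conv_lhs => rw [← sum_antidiagonal_typeComponent_holds α, sum_wedge_left]
  rw [dolbeault_sum _ _ fun pq hpq ↦ isSmoothForm_wedge (hαc pq hpq) hβs]
  rw [Finset.sum_congr rfl fun pq hpq ↦ dolbeault_wedge_of_isOfType_left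
    (isOfType_typeComponent_holds (mem_antidiagonal.1 hpq) α) (hαc pq hpq) hβs]
  rw [sum_add_distrib, ← castDeg_sum, ← sum_wedge_left, ← dolbeault_sum _ _ hαc, ← smul_sum,
    ← sum_wedge_left, sum_antidiagonal_typeComponent_holds α]

end General

end Literature.NumberTheory.Transcendental

end
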